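import Summits.HodgeConjecture.HodgeConjecture.Theorems.F0P6aLineSpecialisation
import HarnessLib
import HarnessLib.Audit.LibrarySuggestionsDenyListCruxes

/-! Import notes («M-142a» (A): canonical bare header; the per-import commentary lives here):
* `Summits.HodgeConjecture.HodgeConjecture.Theorems.F0P6aLineSpecialisation` — ★ twin (LAST part; parts 1–5 ride the import) of tree `Lines/F0_P6a_LineSpecialisation.lean` d6354130763e131e (1864 l.)
* `HarnessLib.Audit.LibrarySuggestionsDenyListCruxes` — «P-κ» carrier (LEAD «M-142d» (1); shim = root of this `Lines` module) -/

/-! # F0_P6a_LineSpecialisation — NEXT EDITION = SHIM (★ re-home, IMPORT-ONLY; K6 L3 column, dealer LA3-plan (g5) PLAN v2).  The 119 declaration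
commands of this workfile (namespace `Summit.HodgeConjecture.HodgeConjecture.Cruxes.HLiu418.F0P6aLineSpecialisation` KEPT ⇒ identical fully-qualified
names) now live in ★ `Theorems/F0P6aLineSpecialisationLetters.lean` (tree :1–:296) → ★ `Theorems/F0P6aLineSpecialisationLayer.lean` (tree :297–:644) →
★ `Theorems/F0P6aLineSpecialisationFibres.lean` (tree :645–:960) → ★ `Theorems/F0P6aLineSpecialisationGeneric.lean` (tree :961–:1285) → ★
`Theorems/F0P6aLineSpecialisationLaws.lean` (tree :1286–:1630) → ★ `Theorems/F0P6aLineSpecialisation.lean` (tree :1631–:1864) — the tree bytes of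
d6354130763e131e split ×6 by the size lint at command-block seams (sections re-opened and their `variable`∕`open`∕`set_option` lines replayed verbatim
in later parts), with its `Lines/` imports switched to their ★ re-homes, 0 statement ∕ proof bytes changed.  This file only imports the last part
(transitively all), so the module `…Cruxes.HLiu418.Lines.F0_P6a_LineSpecialisation` keeps serving every name to its importers (Lines-tree importers:
`F0_P6a_KillEngine`, `F0_P6a_KillEngineW`, `F0_P6a_SpecOrgans`, `F0_P6a_SpecOrgansT`, `F0_P6a_StubFROB`, `F0_P6a_StubFROBRoofGeo`,
`F0_P6a_StubFROBRoofGeoWiring`, `F0_P6a_StubRHO1` — each switches to the ★ module in its own twin ∕ shim).  It declares nothing.  Edition history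
stays in the line card `Lines/F0_P6a_LineSpecialisation.md` and git; future changes are ★-side proposals on the `Theorems/` parts.  HC_CM is proved
only modulo the 7 printed citations (2 remaining named inputs hLiu418 = stmt-HodgeConjecture-24832, h413 = stmt-HodgeConjecture-24833) until rung 0
closes; count-neutral (0 `sorry`, 0 socket, 0 declaration). -/
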